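import Summits.Parity.GeneralizedHardyLittlewood.Theorems.Dhl42StaircaseInstance
import Summits.Parity.GeneralizedHardyLittlewood.Theorems.Dhl42CertInstance
import Literature.NumberTheory.Sieve.ParityWave0MPZClaim

/-!
# DHL[42,2] certificate — Theorem 4.3 at the §7 instance (`Theorem43Instance`); Corollary 6.4 from it

`IsDownClosed` (down-closed within `[0,∞)^k` — NOT Mathlib's `IsLowerSet`), `isDownClosed_OmegaF/G`,
the statement `Corollary64Instance` of Corollary 6.4 at the instance, the grade conditions (4.1)
`GradesCondition` (proved: `gradesCondition_holds`), **`Theorem43Instance`** — Theorem 4.3 (`thm:A`,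
sieving on admissible regions) specialised to the data of Section 7, verbatim over the migrated
definitions with the three distribution estimates stated as the tree's
`Literature.NumberTheory.Sieve.MPZi i ϖ δ` ([Polymath 8a, Claim 2.3]) and the conclusion as the
tree's `Literature.NumberTheory.Sieve.WeakDicksonHardyLittlewood 42 2` ([Polymath 8b, Claim 3.1] =
DHL[42,2]) — and `corollary64_of_theorem43 : Theorem43Instance → Corollary64Instance` (by
`omega_admissible`, `thmA_hypotheses_of_certificate`, measurability, down-closedness and
boundedness). `Theorem43Instance` is the paper's own analytic theorem (its §3/§5/§6.2 inputs are the
theorems of the sibling files); it is not proved here and is consumed only as an explicit hypothesis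
`(h43 : Theorem43Instance)` downstream. LOGICAL RELATION: since
`Theorem43Instance → Corollary64Instance` is proved, the hypothesis is at least as strong as
Corollary 6.4 at the instance (it quantifies over all bounded measurable `F`, `G_m` on the regions,
not only over the certificate's pair); what it buys is isolation — every step of the paper between
Theorem 4.3 and `H₁ ≤ 196` (§3, §5, §6.2, §7) is machine-checked, and what is not is exactly the
proof of Theorem 4.3 (§4) and the symbolic integrations of Lemma 6.1(b),(c). `Theorem43Instance`
VERSUS THE PRINTED THEOREM 4.3: data `k = 42`, `ε = 9/200`, `ε₁ = 10⁻⁴`, `n = 3` grades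
`(i_g, ϖ_g, δ_g) = (1, ϖ₁, δ₁), (2, ϖ₂, δ₂), (2, ϖ₃, δ₃)`, `θ = 1/2 + 2ϖ₃`, `S = 1 + ε`,
`K = 1 − ε`, `ϱ₀ = 10⁻⁵`; hypotheses in order: (4.1) the grade conditions (numeric, kept as a
hypothesis, proved separately as `gradesCondition_holds`), (7) `(1 + ε)θ < 1`, the three estimates
`MPZ^{(i_g)}[ϖ_g, δ_g]` (`MPZi`), "`Ω ⊆ S·R_k`, `Ω' ⊆ K·R_{k−1}` down-closed Lebesgue measurable"
for `Ω = OmegaF`, `Ω' = OmegaG` (the inclusions hold by definition; measurability and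
down-closedness are hypotheses, proved in this file and in `Dhl42CertInstance`,
`Dhl42IntegrabilityCover`), `ϱ₀`-admissibility (`Admissible gradeData42 rho0 OmegaF OmegaG`,
Definition 4.2 as formalised in `Dhl42Staircase`), then for all `F : ℝ⁴² → ℝ` and
`G_1, …, G_42 : ℝ⁴¹ → ℝ` BOUNDED MEASURABLE (in place of the paper's `L²` — a special case, so the
proposition assumes less than the printed theorem) and supported in `Ω` resp. `Ω'`, `⟨F, F⟩ > 0`,
and (4.3) `Σ_m (2⟨F_m, G_m⟩ − ⟨G_m, G_m⟩) > (2/θ)⟨F, F⟩` (`varLHS`, `margAt` of `Dhl42Marginals`);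
conclusion DHL[42,2] (`WeakDicksonHardyLittlewood 42 2`).

Origin: `Dhl42/Theorem43.lean` of the DHL[42,2] certificate package (pub-dhl42 bundle, archive blob
`18cce9e3`; sha256[:16] of the file `cfd7acbd5da97331`; paper snapshot = `paper/main.tex` v1), lines
:54–:175; statements and proofs unchanged except: namespace `TpY4Dhl42` →
`Summit.Parity.GeneralizedHardyLittlewood.Theorems.Dhl42`, the package's `simplexSet n B` replaced
by the tree's definitionally equal `Literature.NumberTheory.Sieve.scaledSimplex n B` (also inside
declaration names), docstrings added where missing (the docstrings of `Corollary64Instance`,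
`Theorem43Instance` re-worded for the tree: package-internal pointers removed, mathematics
unchanged), `#print axioms` lines dropped; `MPZ i ϖ δ` → tree `MPZi i ϖ δ` and `DHL 42` → tree
`WeakDicksonHardyLittlewood 42 2` in `Corollary64Instance` and `Theorem43Instance` (:112 :115 :136
:145; both enter only as opaque hypotheses/conclusion, `corollary64_of_theorem43` passes them
through). Package-internal references in the verbatim docstrings (`Dhl42/….lean`, `Assumed.…`,
`row 9…`, `gen n`, `inputs/COMPARE.md`) refer to that package (paper Appendix B).

Declarations (10): `IsDownClosed`, `bigU_mono_of_le`, `isDownClosed_OmegaF`, `isDownClosed_OmegaG`,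
`Corollary64Instance`, `GradesCondition`, `gradesCondition_holds`, `Theorem43Instance`,
`abs_indicator_le`, `corollary64_of_theorem43`.
-/

open MeasureTheory Set
open Literature.NumberTheory.Sieve (scaledSimplex MPZi WeakDicksonHardyLittlewood)

namespace Summit.Parity.GeneralizedHardyLittlewood.Theorems.Dhl42

noncomputable section

/-! ### Down-closed regions -/

/-- `Ω` is down-closed: with `t` it contains every `t'` with `0 ≤ t' ≤ t` coordinatewise
(Theorem 4.3: "down-closed Lebesgue measurable sets"). -/
def IsDownClosed {k : ℕ} (Ω : Set (Fin k → ℝ)) : Prop :=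
  ∀ ⦃t : Fin k → ℝ⦄, t ∈ Ω → ∀ ⦃t' : Fin k → ℝ⦄, (∀ j, 0 ≤ t' j) → (∀ j, t' j ≤ t j) → t' ∈ Ω

/-- `U_t(u)` is monotone in `t ≥ 0` for the coordinatewise order. -/
theorem bigU_mono_of_le {k : ℕ} {t t' : Fin k → ℝ} (ht : ∀ j, 0 ≤ t j) (h : ∀ j, t' j ≤ t j)
    (u : ℝ) : bigU t' u ≤ bigU t u := by
  unfold bigU
  refine Finset.sum_le_sum fun j _ => ?_
  by_cases h1 : u ≤ t' j
  · rw [if_pos h1, if_pos (le_trans h1 (h j))]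
    exact h j
  · rw [if_neg h1]
    split_ifs
    · exact ht j
    · exact le_rfl

/-- `Ω = OmegaF` is down-closed (Theorem 4.3's hypothesis on the regions): lowering coordinates
inside `[0,∞)^42` lowers the coordinate sum and every `U_t(u)` (`bigU_mono_of_le`). -/
theorem isDownClosed_OmegaF : IsDownClosed OmegaF := by
  intro t ht t' h0 hle
  have hsum : ∑ j, t' j ≤ ∑ j, t j := Finset.sum_le_sum fun j _ => hle j
  refine ⟨⟨h0, le_trans hsum ht.1.2⟩, fun g => ?_⟩
  rcases ht.2 g with h | h
  · exact Or.inl (le_trans hsum h)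
  · exact Or.inr fun l => le_trans (bigU_mono_of_le ht.1.1 hle _) (h l)

/-- `Ω' = OmegaG` is down-closed, for the same reason as `isDownClosed_OmegaF`. -/
theorem isDownClosed_OmegaG : IsDownClosed OmegaG := by
  intro t ht t' h0 hle
  have hsum : ∑ j, t' j ≤ ∑ j, t j := Finset.sum_le_sum fun j _ => hle j
  refine ⟨⟨h0, le_trans hsum ht.1.2⟩, fun g => ?_⟩
  rcases ht.2 g with h | h
  · exact Or.inl (le_trans hsum h)
  · exact Or.inr fun l => le_trans (bigU_mono_of_le ht.1.1 hle _) (h l)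

/-! ### The statement of Corollary 6.4 at the instance -/

/-- **Corollary 6.4 of the paper (`cor:cert`, §6.2) specialised to the Section-7 instance**, as a
proposition over the definitions of `Dhl42DefsParams` … `Dhl42Cover`. Hypotheses, in order:
Proposition 5.3(i)–(iv) and the Definition 5.2 side conditions for the original graded data
(`StaircaseFacts`, proved: `staircaseFacts_hold`); the two reductions of §7.1 (proved:
`banded_subset_gradedF/G`); the cover of `S·R₄₂ ∖ Ω` by the members of eq. (23) (proved:
`Esets_cover`); eq. (7) `(1+ε)θ < 1` (proved: `epsTheta_lt_one`); the three estimates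
`MPZ⁽¹⁾[ϖ₁,δ₁]`, `MPZ⁽²⁾[ϖ₂,δ₂]`, `MPZ⁽²⁾[ϖ₃,δ₃]` as the tree's `MPZi` ([Polymath 8a, Claim 2.3];
available for these exponents by [Polymath 8a, Theorem 2.8], not formalized); then for every choice
of per-member bin families `bf` and upper bounds `L' ≥ 42·L_G`, `X' ≥ 2·Σ√(A B)` (the freedom
granted by the last sentence of Lemma 6.2), the strict certificate inequality
`(2/θ)·I(F₀) < 42·J^K(F₀) − L' − X'` implies DHL[42,2] (the tree's
`WeakDicksonHardyLittlewood 42 2`). A theorem modulo Theorem 4.3 at the instance: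
`corollary64_of_theorem43` below. -/
def Corollary64Instance : Prop :=
  StaircaseFacts → OmegaF ⊆ GradedF → OmegaG ⊆ GradedG →
    (scaledSimplex 42 Sc \ OmegaF ⊆ ⋃ m : Member, Esets m) →
    (1 + eps) * theta < 1 →
    MPZi 1 varpi1 delta1 → MPZi 2 varpi2 delta2 → MPZi 2 varpi3 delta3 →
    ∀ (bf : ∀ m : Member, MemberBins (memberTau0 m)) (L' X' : ℝ),
      42 * LGval ≤ L' → 2 * totalCross bf ≤ X' →
      (2 / theta) * Ival < 42 * JKval - L' - X' → WeakDicksonHardyLittlewood 42 2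

/-! ### Theorem 4.3 at the instance -/

/-- The grade conditions (4.1) `eq:grades` at the instance: `0 < ϖ₁ < ϖ₂ < ϖ₃ < 1/4`,
`0 < δ_g < 1/4 + ϖ_g`. -/
def GradesCondition : Prop :=
  0 < varpi1 ∧ varpi1 < varpi2 ∧ varpi2 < varpi3 ∧ varpi3 < 1 / 4 ∧
    0 < delta1 ∧ delta1 < 1 / 4 + varpi1 ∧ 0 < delta2 ∧ delta2 < 1 / 4 + varpi2 ∧
      0 < delta3 ∧ delta3 < 1 / 4 + varpi3

/-- The grade conditions (4.1) hold for the §7.1 exponents: `0 < ϖ₁ < ϖ₂ < ϖ₃ < 1/4` and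
`0 < δ_g < 1/4 + ϖ_g` (exact rational arithmetic). -/
theorem gradesCondition_holds : GradesCondition := by
  unfold GradesCondition varpi1 varpi2 varpi3 delta1 delta2 delta3
  norm_num

/-- **Theorem 4.3 of the paper (`thm:A`, sieving on admissible regions) specialised to the data of
Section 7** — the hypothesis-by-hypothesis correspondence with the printed theorem is in the module
docstring. NOT formalized (with the symbolic integrations of Lemma 6.1(b),(c), the un-formalized
part of the `k = 42` result): its proof is the [Polymath 8b, Lemma 4.1, Theorems 3.5, 3.6(i),
3.12(i)]-type sieve analysis of Section 4 with the graded prime-sum estimate (Proposition 4.4) and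
the bridge Lemma 4.5. Used downstream only as an explicit hypothesis. -/
def Theorem43Instance : Prop :=
  GradesCondition → (1 + eps) * theta < 1 →
  MPZi 1 varpi1 delta1 → MPZi 2 varpi2 delta2 → MPZi 2 varpi3 delta3 →
  MeasurableSet OmegaF → MeasurableSet OmegaG → IsDownClosed OmegaF → IsDownClosed OmegaG →
  Admissible gradeData42 rho0 OmegaF OmegaG →
  ∀ (F : (Fin 42 → ℝ) → ℝ) (G : Fin 42 → (Fin 41 → ℝ) → ℝ),
    Measurable F → (∃ C, ∀ t, |F t| ≤ C) → (∀ t, t ∉ OmegaF → F t = 0) →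
    (∀ m, Measurable (G m)) → (∀ m, ∃ C, ∀ t', |G m t'| ≤ C) →
    (∀ m t', t' ∉ OmegaG → G m t' = 0) →
    0 < ∫ t, F t ^ 2 →
    2 / theta * ∫ t, F t ^ 2 < varLHS F G →
    WeakDicksonHardyLittlewood 42 2

/-- `|1_s · f| ≤ |f|` pointwise. -/
theorem abs_indicator_le {α : Type*} (s : Set α) (f : α → ℝ) (x : α) :
    |s.indicator f x| ≤ |f x| := by
  by_cases hx : x ∈ s
  · rw [indicator_of_mem hx]
  · rw [indicator_of_notMem hx, abs_zero]
    exact abs_nonneg _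

/-- **Row 9 reduces to Theorem 4.3 at the instance.**  `Corollary64Instance` follows from
`Theorem43Instance` by the theorems of this package: `omega_admissible` (Prop. 5.3, Staircase.lean),
`thmA_hypotheses_of_certificate` (Lemma 6.2 + cover + positivity, CertificateInequality.lean),
`measurableSet_OmegaF/G`, `isDownClosed_OmegaF/G`, and the boundedness/measurability of
`F = F₀1_Ω`, `G_m = (F₀)₁1_{Ω'}` (Integrability.lean).  The first four hypotheses of
`Corollary64Instance` (staircase facts, the two reductions, the cover) are not even needed as
hypotheses any more: they are closed theorems used inside `omega_admissible` and `certSetup42`. -/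
theorem corollary64_of_theorem43 (h43 : Theorem43Instance) : Corollary64Instance := by
  intro _hSF _hΩF _hΩG _hcov hεθ h1 h2 h3 bf L' X' hL hX hcert
  obtain ⟨hpos, hvar⟩ := thmA_hypotheses_of_certificate bf hL hX hcert
  obtain ⟨C, -, hC⟩ := exists_bound_F0
  obtain ⟨C', -, hC'⟩ := exists_bound_F0marg
  exact h43 gradesCondition_holds hεθ h1 h2 h3 measurableSet_OmegaF measurableSet_OmegaG
    isDownClosed_OmegaF isDownClosed_OmegaG omega_admissible
    (OmegaF.indicator F0) (fun _ => OmegaG.indicator F0marg)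
    (measurable_F0.indicator measurableSet_OmegaF)
    ⟨C, fun t => le_trans (abs_indicator_le _ _ _) (hC t)⟩
    (fun t ht => indicator_of_notMem ht _)
    (fun _ => measurable_F0marg.indicator measurableSet_OmegaG)
    (fun _ => ⟨C', fun t' => le_trans (abs_indicator_le _ _ _) (hC' t')⟩)
    (fun _ t' ht' => indicator_of_notMem ht' _)
    hpos hvar

end

end Summit.Parity.GeneralizedHardyLittlewood.Theorems.Dhl42
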